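import Mathlib
import Summits.NavierStokesRegularity.FluidComputer.AbcClassIIEnergy

/-!
# INERTIA-3L instantiation, Part 1: the tail PAIRING BOUND in class-II coordinates, for infinitely
# supported coefficient vectors (instab3 g8, cell `ns-blowup`, 2026-08-27)

HONEST FRAMING (human ruling D-0035): nothing here is a claim about Navier–Stokes blow-up.
WHAT THIS IS NOT: not NS evidence. MODEL lane (Navier–Stokes linearised about the forced ABC flow
`U = abcFlow 1 1 1`, `f = νU`, symmetry class II, certifier units `L_R = −(1/R)|k|² + Π X`); no certificate,
number or census word moves. This is the first file of the KERNEL INSTANTIATION of the INERTIA-3L format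
theorem `LyapunovInertiaCount.finrank_le_of_generator_form_neg` (instab3 g7, p493094) on the class-II
operator (`HOME/instab3/INSTAB3-METHOD.md` §14.6 (1) = `HOME/instab4/KERNEL-CHAIN.md` item K2).

Everything is written in instab4's class-II COORDINATES (`AbcClassIIDefs`: orbit-adapted real orthonormal
basis families `bfam i`, `i : Idx = Σ O, Fin (odim O)`, real first-order matrix `amat`, levels `−|O_i|²/R`;
the coordinate operator is `(L x)_i = −(|O_i|²/R) x_i + Σ_{j ∈ nbrIdx i} amat i j · x_j`, exactly the term of
`AbcClassIISynthesis.certifier_eigen_of_coordinates`). The one analytic input an INERTIA-3L certificate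
uses beyond finite matrix facts is the tail pairing bound `Re⟨w_t, X w_t⟩ ≤ √2‖w_t‖²` for the INFINITELY
supported tail `w_t` of a domain vector. In Cartesian family language this is instab4 g5's
`AbcLatticePairingDomain.abs_re_tsum_inner_crossForm_le` (graph domain). This file transports it to
coordinates:

* §1 cube exhaustions of the lattice and of the index type (`tendsto_sum_cube`, `tendsto_sum_cubeIdx`),
  punctured cubes, regrouping of cube sums by orbits for arbitrary additive targets;
* §2 the NEIGHBOUR-SUM lemma (`sum_nbr_sum_le`, `summable_nbr_sum`: `i ↦ Σ_{j ∈ nbrIdx i} h_j` is summable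
  with `Σ ≤ 288² Σ h`, because `j ∈ nbrIdx i ↔ i ∈ nbrIdx j` and `#nbrIdx ≤ 288²`), the first-order growth of
  the row sums (`norm_rowSum_le`, from `abs_amat_le`) and the absolute summability of the coordinate pairing
  `i ↦ conj(y_i) (Σ_{j ∈ nbrIdx i} amat i j y_j)` for `Σ (1 + |O_i|²)|y_i|² < ∞` (`summable_pairing`);
* §3 the ORBITWISE SYNTHESIS `c(k) = Σ_a y⟨O,a⟩ bfam⟨O,a⟩(k)` of an arbitrary coordinate vector
  (`exists_orbitwise`), its cube identities (`sum_cube_norm_sq`, `sum_cube_pairing`: Parseval and the pairing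
  per orbit, locality `AbcClassIISynthesis.neighbour_value`), transversality and graph-summability;
* §4 **`re_tsum_pairing_le`**: `|Re Σ'_i conj(y_i) Σ_{j ∈ nbrIdx i} amat i j y_j| ≤ √2 · Σ'_i |y_i|²` for every
  `y : Idx → ℂ` with `Σ_i (1 + |O_i|²)|y_i|² < ∞` — the (A4) pairing bound for infinitely supported coordinate
  vectors (the two tail sums are the limits along the cube exhaustion of the lattice sums of the synthesised
  family).

Mathlib + `AbcClassIIEnergy` (transitively the class-II layer and `AbcLatticePairingDomain`); no new
definitions; std axioms. bears_on LADDER-NS N1* T6 / profile W3 (INERTIA-3L). [folklore]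
-/

noncomputable section

open scoped BigOperators ComplexConjugate InnerProductSpace
open Finset Filter Topology

namespace Summit.NavierStokesRegularity.FluidComputer.AbcInertia

open Literature.Analysis.FunctionSpaces Literature.Analysis.FunctionSpaces.Torus
open Literature.Analysis.FunctionSpaces.EuclideanSpace
open Literature.Analysis.FluidPDE Literature.Analysis.FluidPDE.SteadyLattice
open Summit.NavierStokesRegularity.FluidComputer.AbcClassII

/-! ### §1 Cube exhaustions and regrouping by orbits -/

/-- The sup-norm cubes exhaust the lattice. -/
theorem tendsto_cube_atTop : Tendsto cube atTop atTop :=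
  tendsto_atTop_finset_of_monotone (fun _ _ h => cube_mono h)
    (fun k => ⟨AbcClassII.supNorm k, mem_cube_iff_supNorm.mpr le_rfl⟩)

/-- The Galerkin index sets exhaust the index type. -/
theorem tendsto_cubeIdx_atTop : Tendsto cubeIdx atTop atTop :=
  tendsto_atTop_finset_of_monotone cubeIdx_mono exists_mem_cubeIdx

/-- A convergent lattice series is the limit of its cube sums. -/
theorem tendsto_sum_cube {α : Type*} [AddCommMonoid α] [TopologicalSpace α] {g : (Fin 3 → ℤ) → α} {a : α}
    (h : HasSum g a) : Tendsto (fun n => ∑ k ∈ cube n, g k) atTop (𝓝 a) :=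
  h.comp tendsto_cube_atTop

/-- A convergent series over the index type is the limit of its sums over the Galerkin index sets. -/
theorem tendsto_sum_cubeIdx {α : Type*} [AddCommMonoid α] [TopologicalSpace α] {f : Idx → α} {a : α}
    (h : HasSum f a) : Tendsto (fun n => ∑ i ∈ cubeIdx n, f i) atTop (𝓝 a) :=
  h.comp tendsto_cubeIdx_atTop

/-- Cube sums of a function vanishing at the origin are punctured-cube sums. -/
theorem sum_cube_eq_sum_filter {α : Type*} [AddCommMonoid α] {g : (Fin 3 → ℤ) → α} (h0 : g 0 = 0) (n : ℕ) :
    ∑ k ∈ cube n, g k = ∑ k ∈ (cube n).filter (fun k => k ≠ 0), g k := by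
  rw [Finset.sum_filter_of_ne]
  intro k _ hk h
  exact hk (by rw [h, h0])

/-- A punctured-cube sum is the sum over the orbits of the cube of the orbit sums (any additive target). -/
theorem sum_cube_filter_eq' {α : Type*} [AddCommMonoid α] (n : ℕ) (g : (Fin 3 → ℤ) → α) :
    ∑ k ∈ (cube n).filter (fun k => k ≠ 0), g k = ∑ O ∈ cubeOrbits n, ∑ k ∈ O.1, g k := by
  rw [cube_filter_eq_biUnion, Finset.sum_biUnion]
  intro O _ O' _ hne
  exact Orbit.disjoint_of_ne hne

/-- A sum over `cubeIdx n` is the sum over the orbits of the cube of the sums over the basis index. -/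
theorem sum_cubeIdx_eq' {α : Type*} [AddCommMonoid α] (n : ℕ) (f : Idx → α) :
    ∑ i ∈ cubeIdx n, f i = ∑ O ∈ cubeOrbits n, ∑ a : Fin (odim O), f ⟨O, a⟩ :=
  Finset.sum_sigma (cubeOrbits n) (fun O => (Finset.univ : Finset (Fin (odim O)))) (fun i => f i)

/-! ### §2 Neighbour sums, growth of the row sums, summability of the coordinate pairing -/

/-- **Neighbour sums, finite form**: `Σ_{i ∈ F} Σ_{j ∈ nbrIdx i} h_j ≤ 288² · Σ_{j ∈ ⋃_{i∈F} nbrIdx i} h_j`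
for `h ≥ 0` (each `j` is the neighbour of at most `#nbrIdx j ≤ 288²` indices). -/
theorem sum_nbr_sum_le (h : Idx → ℝ) (h0 : ∀ j, 0 ≤ h j) (F : Finset Idx) :
    ∑ i ∈ F, ∑ j ∈ nbrIdx i, h j ≤ 288 * 288 * ∑ j ∈ F.biUnion nbrIdx, h j := by
  classical
  have hcomm : ∑ i ∈ F, ∑ j ∈ nbrIdx i, h j =
      ∑ j ∈ F.biUnion nbrIdx, ∑ i ∈ F.filter (fun i => j ∈ nbrIdx i), h j := by
    refine Finset.sum_comm' ?_
    intro i j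
    simp only [Finset.mem_filter, Finset.mem_biUnion]
    constructor
    · rintro ⟨hi, hj⟩; exact ⟨⟨hi, hj⟩, i, hi, hj⟩
    · rintro ⟨⟨hi, hj⟩, _⟩; exact ⟨hi, hj⟩
  rw [hcomm, Finset.mul_sum]
  refine Finset.sum_le_sum fun j _ => ?_
  rw [Finset.sum_const, nsmul_eq_mul]
  refine mul_le_mul_of_nonneg_right ?_ (h0 j)
  have hsub : F.filter (fun i => j ∈ nbrIdx i) ⊆ nbrIdx j := by
    intro i hi
    exact (mem_nbrIdx_comm j i).mpr (Finset.mem_filter.mp hi).2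
  have := (Finset.card_le_card hsub).trans (card_nbrIdx_le j)
  exact_mod_cast this

/-- **Neighbour sums**: for a nonnegative summable `h`, `i ↦ Σ_{j ∈ nbrIdx i} h_j` is summable and
`Σ'_i Σ_{j ∈ nbrIdx i} h_j ≤ 288² · Σ'_j h_j`. -/
theorem summable_nbr_sum {h : Idx → ℝ} (h0 : ∀ j, 0 ≤ h j) (hs : Summable h) :
    Summable (fun i => ∑ j ∈ nbrIdx i, h j) ∧
      ∑' i, ∑ j ∈ nbrIdx i, h j ≤ 288 * 288 * ∑' j, h j := by
  have hb : ∀ F : Finset Idx, ∑ i ∈ F, ∑ j ∈ nbrIdx i, h j ≤ 288 * 288 * ∑' j, h j := by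
    intro F
    refine (sum_nbr_sum_le h h0 F).trans ?_
    exact mul_le_mul_of_nonneg_left (hs.sum_le_tsum _ (fun j _ => h0 j)) (by norm_num)
  have hnn : ∀ i, 0 ≤ ∑ j ∈ nbrIdx i, h j := fun i => Finset.sum_nonneg fun j _ => h0 j
  exact ⟨summable_of_sum_le hnn hb, tsum_le_of_sum_le' (mul_nonneg (by norm_num) (tsum_nonneg h0)) hb⟩

/-- **First-order growth of the row sums**: `‖Σ_{j ∈ nbrIdx i} amat i j y_j‖ ≤ 2592 Σ_{j} √(1+|O_j|²) |y_j|`. -/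
theorem norm_rowSum_le (y : Idx → ℂ) (i : Idx) :
    ‖∑ j ∈ nbrIdx i, ((amat i j : ℝ) : ℂ) * y j‖ ≤
      2592 * ∑ j ∈ nbrIdx i, Real.sqrt (1 + onormSq j.1) * ‖y j‖ := by
  refine (norm_sum_le _ _).trans ?_
  rw [Finset.mul_sum]
  refine Finset.sum_le_sum fun j _ => ?_
  rw [norm_mul, Complex.norm_real, Real.norm_eq_abs]
  have h := abs_amat_le i j
  have := mul_le_mul_of_nonneg_right h (norm_nonneg (y j))
  linarith

/-- The summand of the coordinate pairing is dominated:
`|y_i| · ‖Σ_j amat i j y_j‖ ≤ 1296 (#nbrIdx i · |y_i|² + Σ_{j ∈ nbrIdx i} (1+|O_j|²)|y_j|²)`. -/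
theorem norm_mul_rowSum_le (y : Idx → ℂ) (i : Idx) :
    ‖y i‖ * ‖∑ j ∈ nbrIdx i, ((amat i j : ℝ) : ℂ) * y j‖ ≤
      1296 * (((nbrIdx i).card : ℝ) * ‖y i‖ ^ 2 + ∑ j ∈ nbrIdx i, (1 + onormSq j.1) * ‖y j‖ ^ 2) := by
  have h1 := mul_le_mul_of_nonneg_left (norm_rowSum_le y i) (norm_nonneg (y i))
  refine h1.trans ?_
  have hterm : ∀ j ∈ nbrIdx i, ‖y i‖ * (Real.sqrt (1 + onormSq j.1) * ‖y j‖) ≤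
      (1 / 2) * (‖y i‖ ^ 2 + (1 + onormSq j.1) * ‖y j‖ ^ 2) := by
    intro j _
    have hq : 0 ≤ 1 + onormSq j.1 := by linarith [onormSq_nonneg j.1]
    have hs : Real.sqrt (1 + onormSq j.1) ^ 2 = 1 + onormSq j.1 := Real.sq_sqrt hq
    nlinarith [sq_nonneg (‖y i‖ - Real.sqrt (1 + onormSq j.1) * ‖y j‖), norm_nonneg (y i),
      norm_nonneg (y j), Real.sqrt_nonneg (1 + onormSq j.1)]
  calc ‖y i‖ * (2592 * ∑ j ∈ nbrIdx i, Real.sqrt (1 + onormSq j.1) * ‖y j‖)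
      = 2592 * ∑ j ∈ nbrIdx i, ‖y i‖ * (Real.sqrt (1 + onormSq j.1) * ‖y j‖) := by
        rw [Finset.mul_sum, Finset.mul_sum, Finset.mul_sum]
        refine Finset.sum_congr rfl fun j _ => by ring
    _ ≤ 2592 * ∑ j ∈ nbrIdx i, (1 / 2) * (‖y i‖ ^ 2 + (1 + onormSq j.1) * ‖y j‖ ^ 2) :=
        mul_le_mul_of_nonneg_left (Finset.sum_le_sum hterm) (by norm_num)
    _ = 1296 * (((nbrIdx i).card : ℝ) * ‖y i‖ ^ 2 + ∑ j ∈ nbrIdx i, (1 + onormSq j.1) * ‖y j‖ ^ 2) := by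
        rw [← Finset.mul_sum, Finset.sum_add_distrib, Finset.sum_const, nsmul_eq_mul]
        ring

/-- Square-summability from the weighted summability. -/
theorem summable_norm_sq_of_weighted {y : Idx → ℂ}
    (hy : Summable fun i : Idx => (1 + onormSq i.1) * ‖y i‖ ^ 2) :
    Summable fun i : Idx => ‖y i‖ ^ 2 := by
  refine Summable.of_nonneg_of_le (fun i => sq_nonneg _) (fun i => ?_) hy
  have := onormSq_nonneg i.1
  nlinarith [sq_nonneg ‖y i‖]

/-- **The coordinate pairing is absolutely summable** on `Σ (1+|O_i|²)|y_i|² < ∞`. -/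
theorem summable_norm_pairing {y : Idx → ℂ}
    (hy : Summable fun i : Idx => (1 + onormSq i.1) * ‖y i‖ ^ 2) :
    Summable fun i : Idx => ‖y i‖ * ‖∑ j ∈ nbrIdx i, ((amat i j : ℝ) : ℂ) * y j‖ := by
  have h2 := summable_norm_sq_of_weighted hy
  have hn := (summable_nbr_sum (h := fun j => (1 + onormSq j.1) * ‖y j‖ ^ 2)
    (fun j => mul_nonneg (by linarith [onormSq_nonneg j.1]) (sq_nonneg _)) hy).1
  have hmaj : Summable fun i : Idx =>
      1296 * ((288 * 288 : ℝ) * ‖y i‖ ^ 2 + ∑ j ∈ nbrIdx i, (1 + onormSq j.1) * ‖y j‖ ^ 2) :=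
    ((h2.mul_left _).add hn).mul_left _
  refine Summable.of_nonneg_of_le (fun i => mul_nonneg (norm_nonneg _) (norm_nonneg _)) (fun i => ?_) hmaj
  refine (norm_mul_rowSum_le y i).trans ?_
  have hc : ((nbrIdx i).card : ℝ) ≤ 288 * 288 := by exact_mod_cast card_nbrIdx_le i
  have := mul_le_mul_of_nonneg_right hc (sq_nonneg ‖y i‖)
  nlinarith [Finset.sum_nonneg (fun j (_ : j ∈ nbrIdx i) =>
    mul_nonneg (by linarith [onormSq_nonneg j.1] : (0 : ℝ) ≤ 1 + onormSq j.1) (sq_nonneg ‖y j‖))]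

/-- The coordinate pairing `i ↦ conj(y_i) · Σ_{j ∈ nbrIdx i} amat i j y_j` is summable. -/
theorem summable_pairing {y : Idx → ℂ}
    (hy : Summable fun i : Idx => (1 + onormSq i.1) * ‖y i‖ ^ 2) :
    Summable fun i : Idx => (starRingEnd ℂ) (y i) * ∑ j ∈ nbrIdx i, ((amat i j : ℝ) : ℂ) * y j := by
  refine Summable.of_norm ?_
  refine (summable_norm_pairing hy).congr fun i => ?_
  rw [norm_mul, Complex.norm_conj]

/-! ### §3 Orbitwise synthesis of a coordinate vector -/

/-- **Orbitwise synthesis**: every coordinate vector `y` is the coordinate vector of a family `c` with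
`c 0 = 0` and `c(k) = Σ_a y⟨O,a⟩ • bfam⟨O,a⟩(k)` on every orbit `O` (finitely many terms per frequency). -/
theorem exists_orbitwise (y : Idx → ℂ) : ∃ c : Fam, c 0 = 0 ∧
    ∀ (O : Orbit) (k : Fin 3 → ℤ), k ∈ O.1 → c k = ∑ a : Fin (odim O), y ⟨O, a⟩ • bfam ⟨O, a⟩ k := by
  classical
  refine ⟨fun k => if hk : k = 0 then 0 else
    ∑ a : Fin (odim (toOrbit k hk)), y ⟨toOrbit k hk, a⟩ • bfam ⟨toOrbit k hk, a⟩ k, by simp, ?_⟩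
  intro O k hkO
  have hk : k ≠ 0 := O.ne_zero_of_mem hkO
  have hO : toOrbit k hk = O := (toOrbit_eq_iff hk O).mpr hkO
  subst hO
  simp only [dif_neg hk]

section Orbitwise

variable {y : Idx → ℂ} {c : Fam} (hc0 : c 0 = 0)
  (hc : ∀ (O : Orbit) (k : Fin 3 → ℤ), k ∈ O.1 → c k = ∑ a : Fin (odim O), y ⟨O, a⟩ • bfam ⟨O, a⟩ k)

include hc in
/-- **Parseval on a cube**: `Σ_{k ∈ cube n ∖ 0} ‖c k‖² = Σ_{i ∈ cubeIdx n} |y_i|²`. -/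
theorem sum_cube_norm_sq (n : ℕ) :
    ∑ k ∈ (cube n).filter (fun k => k ≠ 0), ‖c k‖ ^ 2 = ∑ i ∈ cubeIdx n, ‖y i‖ ^ 2 := by
  rw [sum_cube_filter_eq' n (fun k => ‖c k‖ ^ 2), sum_cubeIdx_eq' n (fun i => ‖y i‖ ^ 2)]
  refine Finset.sum_congr rfl fun O _ => ?_
  rw [← sum_norm_sq_orbitExpansion O y]
  refine Finset.sum_congr rfl fun k hk => ?_
  rw [hc O k hk, Finset.sum_apply]
  rfl

include hc hc0 in
/-- **The pairing on a cube, in coordinates**: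
`Σ_{k ∈ cube n ∖ 0} ⟪c k, Π_k X c(k)⟫ = Σ_{i ∈ cubeIdx n} conj(y_i) Σ_{j ∈ nbrIdx i} amat i j y_j`
(on each orbit `X c` only sees the finite combination over the neighbouring orbits — locality). -/
theorem sum_cube_pairing (n : ℕ) :
    ∑ k ∈ (cube n).filter (fun k => k ≠ 0),
        (inner ℂ (c k) (Torus.lerayCoeff k (crossForm 1 1 1 c k)) : ℂ) =
      ∑ i ∈ cubeIdx n, (starRingEnd ℂ) (y i) * ∑ j ∈ nbrIdx i, ((amat i j : ℝ) : ℂ) * y j := by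
  classical
  rw [sum_cube_filter_eq' n, sum_cubeIdx_eq' n]
  refine Finset.sum_congr rfl fun O _ => ?_
  -- on the orbit `O`, `X c = X G` with `G` the finite combination over the neighbouring orbits
  have hXG : ∀ (a : Fin (odim O)), ∀ k ∈ O.1,
      crossForm 1 1 1 c k = crossForm 1 1 1 (∑ j ∈ nbrIdx ⟨O, a⟩, y j • bfam j) k := by
    intro a k hk
    have hcG : ∀ s ∈ Torus.abcFreq, c (k - s) = (∑ j ∈ nbrIdx ⟨O, a⟩, y j • bfam j) (k - s) :=
      fun s hs => neighbour_value c y hc hc0 O hk hs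
    have h0 : crossForm 1 1 1 (c - ∑ j ∈ nbrIdx ⟨O, a⟩, y j • bfam j) k = 0 :=
      AbcLatticeLocality.crossForm_eq_zero_of_neighbours 1 1 1 _ k fun s hs => by
        rw [Pi.sub_apply, hcG s hs, sub_self]
    have h1 := crossForm_add 1 1 1 (∑ j ∈ nbrIdx ⟨O, a⟩, y j • bfam j)
      (c - ∑ j ∈ nbrIdx ⟨O, a⟩, y j • bfam j) k
    rw [add_sub_cancel, h0, add_zero] at h1
    exact h1
  -- expand `c k` on the orbit and swap the sums
  have e1 : ∀ k ∈ O.1, (inner ℂ (c k) (Torus.lerayCoeff k (crossForm 1 1 1 c k)) : ℂ) =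
      ∑ a : Fin (odim O), (starRingEnd ℂ) (y ⟨O, a⟩) *
        (inner ℂ (bfam ⟨O, a⟩ k) (Torus.lerayCoeff k (crossForm 1 1 1 c k)) : ℂ) := by
    intro k hk
    rw [hc O k hk, sum_inner]
    exact Finset.sum_congr rfl fun a _ => by rw [inner_smul_left]
  rw [Finset.sum_congr rfl e1, Finset.sum_comm]
  refine Finset.sum_congr rfl fun a _ => ?_
  rw [← Finset.mul_sum]
  congr 1
  rw [Finset.sum_congr rfl fun k hk => by rw [hXG a k hk]]
  exact sum_inner_bfam_lerayCrossForm_section (nbrIdx ⟨O, a⟩) y ⟨O, a⟩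

include hc hc0 in
/-- The synthesised family is transversal (`AbcClassIISynthesis.kdot_of_coordinates`). -/
theorem kdot_orbitwise (k : Fin 3 → ℤ) : ∑ j : Fin 3, ((k j : ℤ) : ℂ) * c k j = 0 :=
  kdot_of_coordinates c y hc hc0 k

include hc hc0 in
/-- **Graph-summability of the synthesised family** from `Σ (1+|O_i|²)|y_i|² < ∞`. -/
theorem summable_weight_norm_sq_orbitwise
    (hy : Summable fun i : Idx => (1 + onormSq i.1) * ‖y i‖ ^ 2) :
    Summable fun k : Fin 3 → ℤ => (1 + freqNormSq k) * ‖c k‖ ^ 2 := by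
  have hy1 : Summable fun i : Idx => (1 + onormSq i.1) ^ 1 * ‖y i‖ ^ 2 := by simpa using hy
  refine summable_of_sum_le (fun k => mul_nonneg (by linarith [freqNormSq_nonneg k]) (sq_nonneg _))
    (c := ∑' i : Idx, (1 + onormSq i.1) ^ 1 * ‖y i‖ ^ 2) fun T => ?_
  have h := sum_weight_norm_sq_le c y hc hc0 1 hy1 T
  simpa using h

include hc in
/-- `Σ'_k ‖c k‖² = Σ'_i |y_i|²` (both are limits of the same cube sums). -/
theorem tsum_norm_sq_orbitwise (hy : Summable fun i : Idx => ‖y i‖ ^ 2)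
    (hcs : Summable fun k : Fin 3 → ℤ => ‖c k‖ ^ 2) (hc0' : c 0 = 0) :
    ∑' k : Fin 3 → ℤ, ‖c k‖ ^ 2 = ∑' i : Idx, ‖y i‖ ^ 2 := by
  have h1 := tendsto_sum_cube hcs.hasSum
  have h2 := tendsto_sum_cubeIdx hy.hasSum
  have h3 : (fun n => ∑ k ∈ cube n, ‖c k‖ ^ 2) = fun n => ∑ i ∈ cubeIdx n, ‖y i‖ ^ 2 := by
    funext n
    rw [sum_cube_eq_sum_filter (g := fun k => ‖c k‖ ^ 2) (by rw [hc0']; simp) n]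
    exact sum_cube_norm_sq hc n
  rw [h3] at h1
  exact tendsto_nhds_unique h1 h2

end Orbitwise

/-! ### §4 The pairing bound for infinitely supported coordinate vectors -/

/-- **(A4) in coordinates, infinite support.** For every `y : Idx → ℂ` with `Σ_i (1+|O_i|²)|y_i|² < ∞`:
`|Re Σ'_i conj(y_i) · Σ_{j ∈ nbrIdx i} amat i j · y_j| ≤ √2 · Σ'_i |y_i|²`. The tail pairing bound of an
INERTIA-3L certificate (PREREG-INERTIA-3L §3 / INSTAB3-METHOD §14.2 «pairing bound (kernel (A4)) applied to
the vector supported on t»; INERTIA-I4 §3 (ii) and §9 (d)). -/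
theorem re_tsum_pairing_le {y : Idx → ℂ}
    (hy : Summable fun i : Idx => (1 + onormSq i.1) * ‖y i‖ ^ 2) :
    |(∑' i : Idx, (starRingEnd ℂ) (y i) * ∑ j ∈ nbrIdx i, ((amat i j : ℝ) : ℂ) * y j).re| ≤
      Real.sqrt 2 * ∑' i : Idx, ‖y i‖ ^ 2 := by
  classical
  obtain ⟨c, hc0, hc⟩ := exists_orbitwise y
  have hct := kdot_orbitwise (y := y) hc0 hc
  have hcw := summable_weight_norm_sq_orbitwise (y := y) hc0 hc hy
  -- the family pairing bound on the graph domain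
  obtain ⟨hps, hpb⟩ := AbcLatticePairingDomain.abs_re_tsum_inner_crossForm_le c hct hcw
  change Summable (fun k : Fin 3 → ℤ => (inner ℂ (c k) (crossForm 1 1 1 c k) : ℂ)) at hps
  change |(∑' k : Fin 3 → ℤ, (inner ℂ (c k) (crossForm 1 1 1 c k) : ℂ)).re| ≤
    Real.sqrt 2 * ∑' k : Fin 3 → ℤ, ‖c k‖ ^ 2 at hpb
  -- insert the projector (transversality; at `k = 0` both sides vanish)
  have hproj : ∀ k : Fin 3 → ℤ, (inner ℂ (c k) (crossForm 1 1 1 c k) : ℂ) =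
      (inner ℂ (c k) (Torus.lerayCoeff k (crossForm 1 1 1 c k)) : ℂ) := by
    intro k
    by_cases hk : k = 0
    · rw [hk, hc0, inner_zero_left, inner_zero_left]
    · rw [AbcLinearisedPairing.inner_lerayCoeff_of_transversal hk (hct k)]
  have hps' : Summable (fun k : Fin 3 → ℤ => (inner ℂ (c k) (Torus.lerayCoeff k (crossForm 1 1 1 c k)) : ℂ)) :=
    hps.congr hproj
  have hpe : (∑' k : Fin 3 → ℤ, (inner ℂ (c k) (crossForm 1 1 1 c k) : ℂ)) =
      ∑' k : Fin 3 → ℤ, (inner ℂ (c k) (Torus.lerayCoeff k (crossForm 1 1 1 c k)) : ℂ) :=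
    tsum_congr hproj
  -- the lattice pairing is the limit of the coordinate cube sums, i.e. the coordinate pairing
  have hy2 := summable_norm_sq_of_weighted hy
  have hP := summable_pairing hy
  have t1 := tendsto_sum_cube hps'.hasSum
  have t2 := tendsto_sum_cubeIdx hP.hasSum
  have e12 : (fun n => ∑ k ∈ cube n, (inner ℂ (c k) (Torus.lerayCoeff k (crossForm 1 1 1 c k)) : ℂ)) =
      fun n => ∑ i ∈ cubeIdx n, (starRingEnd ℂ) (y i) * ∑ j ∈ nbrIdx i, ((amat i j : ℝ) : ℂ) * y j := by
    funext n
    rw [sum_cube_eq_sum_filter (g := fun k => (inner ℂ (c k) (Torus.lerayCoeff k (crossForm 1 1 1 c k)) : ℂ))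
      (by rw [hc0, inner_zero_left]) n]
    exact sum_cube_pairing hc0 hc n
  rw [e12] at t1
  have hPeq : (∑' k : Fin 3 → ℤ, (inner ℂ (c k) (Torus.lerayCoeff k (crossForm 1 1 1 c k)) : ℂ)) =
      ∑' i : Idx, (starRingEnd ℂ) (y i) * ∑ j ∈ nbrIdx i, ((amat i j : ℝ) : ℂ) * y j :=
    tendsto_nhds_unique t1 t2
  -- the norms
  have hcs : Summable fun k : Fin 3 → ℤ => ‖c k‖ ^ 2 := by
    refine Summable.of_nonneg_of_le (fun k => sq_nonneg _) (fun k => ?_) hcw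
    have := freqNormSq_nonneg k
    nlinarith [sq_nonneg ‖c k‖]
  have hNeq := tsum_norm_sq_orbitwise (y := y) hc hy2 hcs hc0
  rw [hpe, hPeq, hNeq] at hpb
  exact hpb

/-- One-sided form: `Re Σ'_i conj(y_i) Σ_j amat i j y_j ≤ √2 Σ'_i |y_i|²`. -/
theorem re_tsum_pairing_le' {y : Idx → ℂ}
    (hy : Summable fun i : Idx => (1 + onormSq i.1) * ‖y i‖ ^ 2) :
    (∑' i : Idx, (starRingEnd ℂ) (y i) * ∑ j ∈ nbrIdx i, ((amat i j : ℝ) : ℂ) * y j).re ≤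
      Real.sqrt 2 * ∑' i : Idx, ‖y i‖ ^ 2 :=
  (le_abs_self _).trans (re_tsum_pairing_le hy)

end Summit.NavierStokesRegularity.FluidComputer.AbcInertia

end
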